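import Summits.AnomalousDissipation.AnomalousDissipation.Theorems.FloorCertificate.Negative.InjectedBeatTools
import Summits.AnomalousDissipation.AnomalousDissipation.Theorems.FloorCertificate.Negative.FixedMultiplierTools

/-!
# `TaylorCertificates.FloorCertificate` (stmt-AnomalousDissipation-14091) — negative side IV:
# no FROZEN multiplier certifies the floor, for any force, whatever the (ν-dependent) weight

cdisprove seat `refuter-cdisprove-stmt-AnomalousDissipation-14091-g2-0` (cycle 2), 2026-08-16.

The natural strengthening `FloorCertificateFixedMultiplier` of the crux — ONE cylindrical multiplier `Φ₁`
(smooth test fields of any resolution and a fixed profile, chosen after `f` but before `ν`) together with a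
FREE weight `θ₁ = θ₁(ν) ≤ 0` — is FALSE for EVERY force (`not_floorCertificateFixedMultiplier`). It sits strictly
between `FloorCertificateUniform` (both frozen; `Negative/Uniform.lean`) and the crux, and is incomparable with
`FloorCertificateFixedResolution` (`Negative/FixedResolution.lean`). Together the three refutations say: in any
witness of `FloorCertificate` the `ν`-dependence must sit in the MULTIPLIER (its fields or profile), its
resolution must diverge, and re-weighting the energy never substitutes for either.

Witness (injected frozen-multiplier beat): see the docstring of `not_floorCertificateFixedMultiplier`.
-/

noncomputable section

set_option linter.dupNamespace false

open MeasureTheory UnitAddTorus Matrix Filter Topology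
open scoped InnerProductSpace ENNReal ComplexConjugate

namespace Summit.AnomalousDissipation.AnomalousDissipation.Theorems.FloorCertificate.Negative

open Literature.Analysis.FunctionSpaces Literature.Analysis.FluidPDE
open Summit.AnomalousDissipation.AnomalousDissipation.Theses.TaylorCertificates
open Summit.AnomalousDissipation.AnomalousDissipation.Theorems.TaylorCertificatePair.Negative

/-! ### The strengthening of a frozen multiplier and its refutation -/

/-- NATURAL STRENGTHENING of the crux — a FROZEN MULTIPLIER with a free weight: ONE cylindrical `Φ₁` (smooth
test fields of any resolution, fixed profile) chosen after `f` but before `ν`, and for every `ν ∈ (0, ν₀)` SOME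
weight `θ₁ = θ₁(ν) ≤ 0`. Between `FloorCertificateUniform` (both frozen) and the crux; incomparable with
`FloorCertificateFixedResolution`. FALSE for every force (`not_floorCertificateFixedMultiplier`). -/
def FloorCertificateFixedMultiplier : Prop :=
  ∃ f : (UnitAddTorus (Fin 3) → EuclideanSpace ℝ (Fin 3)), Torus.IsSmooth f ∧ Torus.IsDivFree f ∧ Torus.HasZeroMean f ∧
    ∃ (ε₀ ν₀ : ℝ) (Φ₁ : Torus.CylindricalTest (Fin 3)), 0 < ε₀ ∧ 0 < ν₀ ∧
      ∀ ν : ℝ, 0 < ν → ν < ν₀ → ∃ θ₁ : ℝ, θ₁ ≤ 0 ∧ ∀ u : (Torus.energySpace (Fin 3)), FloorIneq ν f Φ₁ θ₁ ε₀ u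

set_option maxHeartbeats 1600000 in
/-- **No frozen multiplier certifies the floor, for any force, whatever the weights** (refutation of
`FloorCertificateFixedMultiplier`). Witness: the INJECTED frozen-multiplier beat. Let `u₀ = Re(e_{k₀} ĉ)`,
`ĉ = f̂(k₀) ≠ 0` (energy input `(u₀, f) = ‖ĉ‖²`), `W := Φ₁'(u₀)`, `M₁ := (f, W)`. If `M₁ < ε₀` the floor at `u₀`
fails for small `ν` (no self-interaction; the injection signs away ANY weight `θ₁(ν) ≤ 0`). If `M₁ ≥ ε₀` then `W`
has a mode `q ≠ 0`; two waves `Re(e_{(t+1)r} zA) + Re(e_{(t+1)r+q} zB)` escaping along a ray `r ⊥ q`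
(`frame_selection`) added to `u₀` leave the coordinates asymptotically unchanged (Riemann–Lebesgue), so
`Φ₁'(u₀ + waves) → W` coefficientwise; of the pair formula only the beat `−πA²|q||ζ|` at `q` survives in the limit
`t → ∞` — the nine tail terms die by the WEIGHTED Riemann–Lebesgue lemma (`tendsto_tail`; the injected mode makes
some transversal factors grow like `|κ_t|`). With `πA²|q||ζ| ≥ M₁ + 2` the inviscid part of the floor tends to
`≤ −2` while the energy input tends to `‖ĉ‖² > 0`; fix `t`, then `ν` small (upper bounds only): for EVERY
`θ₁ ≤ 0` the floor at the beat state reads `ε₀ ≤ 1/4 − 1 + 1/4`. MORAL: the `ν`-dependence of a witness of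
`FloorCertificate` must sit in the multiplier `Φ₁` itself (and by `not_floorCertificateFixedResolution` its
resolution must diverge); re-weighting the energy is worthless. -/
theorem not_floorCertificateFixedMultiplier : ¬ FloorCertificateFixedMultiplier := by
  rintro ⟨f, hfs, hdiv, hmean, ε₀, ν₀, Φ, hε₀, hν₀, hcert⟩
  have hfi : Integrable f volume := hfs.integrable
  have hF2nn : 0 ≤ ∫ x, ‖f x‖ ^ 2 := integral_nonneg fun x => by positivity
  /- Step 0: the force is nonzero (rest at `ν₀/2`). -/
  have hν₀2 : 0 < ν₀ / 2 := half_pos hν₀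
  obtain ⟨θh, hθh, hallh⟩ := hcert (ν₀ / 2) hν₀2 (by linarith)
  have hF2 : 0 < ∫ x, ‖f x‖ ^ 2 := floorFamily_force_ne_zero hfs hε₀ hν₀2 ⟨Φ, θh, hθh, hallh⟩
  /- Step 1: the injected mode `u₀ = Re(e_{k₀} ĉ)`. -/
  obtain ⟨k₀, hk₀, hck⟩ := exists_fc_ne_zero_of_force hfs hmean hF2
  obtain ⟨ĉ, hĉdef⟩ : ∃ ĉ : (EuclideanSpace ℂ (Fin 3)), ĉ = mFourierCoeff (EuclideanSpace.complexify ∘ f) k₀ := ⟨_, rfl⟩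
  rw [← hĉdef] at hck
  obtain ⟨c, hcdef⟩ : ∃ c : ℝ, c = ‖ĉ‖ := ⟨_, rfl⟩
  have hc : 0 < c := by rw [hcdef]; exact norm_pos_iff.2 hck
  have hc2 : 0 < c ^ 2 := by positivity
  set z₀ : (EuclideanSpace ℂ (Fin 3)) := ((((1 : ℝ)) : ℂ) • ĉ) with hz₀def
  have hdz : ((fun j => ((k₀) j : ℂ)) ⬝ᵥ (WithLp.ofLp (z₀))) = 0 := by
    rw [hz₀def, hĉdef]; exact dotc_injected hfs hdiv k₀ 1
  have hz₀ : ‖z₀‖ = c := by rw [hz₀def, norm_injected zero_le_one ĉ, one_mul, hcdef]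
  have hinj : (⟪z₀, mFourierCoeff (EuclideanSpace.complexify ∘ f) k₀⟫_ℂ).re = c ^ 2 := by
    rw [hz₀def, hcdef, hĉdef, injection_value k₀ 1, one_mul]
  obtain ⟨ue, hue⟩ := exists_state (![k₀] : Fin 1 → (Fin 3 → ℤ)) (![z₀] : Fin 1 → (EuclideanSpace ℂ (Fin 3)))
    (one_ne_zero_gen hk₀) (one_dotc_gen hdz)
  have hWs : Torus.IsSmooth (Φ.grad ue) := isSmooth_grad Φ ue
  obtain ⟨M₁, hM₁def⟩ : ∃ M₁ : ℝ, M₁ = ∫ x, ⟪f x, Φ.grad ue x⟫_ℝ := ⟨_, rfl⟩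
  -- energies of the injected mode
  have hsum1 : ∑ m, ‖(![z₀] : Fin 1 → (EuclideanSpace ℂ (Fin 3))) m‖ = c := by
    simp only [Fin.sum_univ_one, Matrix.cons_val_fin_one]; exact hz₀
  have hint1 : ∫ x, ‖(∑ mm, Torus.realTrigPoly {(![k₀] : Fin 1 → (Fin 3 → ℤ)) mm} (fun _ => (![z₀] : Fin 1 → (EuclideanSpace ℂ (Fin 3))) mm)) x‖ ^ 2 ≤ c ^ 2 := by
    refine integral_norm_sq_modes_le.trans ?_
    rw [hsum1]
  have hpair1 : ∫ x, ⟪(∑ mm, Torus.realTrigPoly {(![k₀] : Fin 1 → (Fin 3 → ℤ)) mm} (fun _ => (![z₀] : Fin 1 → (EuclideanSpace ℂ (Fin 3))) mm)) x, f x⟫_ℝ = c ^ 2 := by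
    rw [integral_inner_modes_left hfi]
    simp only [Fin.sum_univ_one, Matrix.cons_val_fin_one]
    exact hinj
  by_cases hcase : M₁ < ε₀
  · /- Case A: the frozen multiplier does not push enough at `u₀`; `u₀` itself violates the floor. -/
    obtain ⟨E₀, hE₀def⟩ : ∃ E₀ : ℝ, E₀ = (Torus.eGradNormSq ((∑ mm, Torus.realTrigPoly {(![k₀] : Fin 1 → (Fin 3 → ℤ)) mm} (fun _ => (![z₀] : Fin 1 → (EuclideanSpace ℂ (Fin 3))) mm)))).toReal := ⟨_, rfl⟩
    have hE₀ : 0 ≤ E₀ := by rw [hE₀def]; exact ENNReal.toReal_nonneg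
    obtain ⟨Λ₀, hΛ₀def⟩ : ∃ Λ₀ : ℝ, Λ₀ = ∫ x, ⟪(∑ mm, Torus.realTrigPoly {(![k₀] : Fin 1 → (Fin 3 → ℤ)) mm} (fun _ => (![z₀] : Fin 1 → (EuclideanSpace ℂ (Fin 3))) mm)) x, Torus.laplacian (Φ.grad ue) x⟫_ℝ := ⟨_, rfl⟩
    obtain ⟨ν₁, hν₁, hdem⟩ := exists_threshold (a₁ := E₀) (a₂ := E₀) (a₃ := |Λ₀|) (a₄ := c ^ 2)
      (b₁ := (ε₀ - M₁) / 4) (b₂ := c ^ 2 / 2) (b₃ := (ε₀ - M₁) / 4) (b₄ := ∫ x, ‖f x‖ ^ 2)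
      hE₀ hE₀ (abs_nonneg _) (sq_nonneg _) (by linarith) (by positivity) (by linarith) hF2
    have hν : 0 < min ν₁ (min 1 (ν₀ / 2)) := lt_min hν₁ (lt_min one_pos hν₀2)
    have hνν₀ : min ν₁ (min 1 (ν₀ / 2)) < ν₀ :=
      ((min_le_right _ _).trans (min_le_right _ _)).trans_lt (half_lt_self hν₀)
    have hν1 : min ν₁ (min 1 (ν₀ / 2)) ≤ 1 := (min_le_right _ _).trans (min_le_left _ _)
    obtain ⟨hd1, hd2, hd3, hd4⟩ := hdem _ hν (min_le_left _ _)
    obtain ⟨θ, hθ, hall⟩ := hcert _ hν hνν₀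
    generalize min ν₁ (min 1 (ν₀ / 2)) = ν at hν hνν₀ hν1 hd1 hd2 hd3 hd4 hall
    have hfin : Torus.eGradNormSq (((ue : (Torus.energySpace (Fin 3))) : (Lp (EuclideanSpace ℝ (Fin 3)) 2 (volume : Measure (UnitAddTorus (Fin 3))))) : (UnitAddTorus (Fin 3)) → (EuclideanSpace ℝ (Fin 3))) ≠ ⊤ := by
      rw [eGradNormSq_congr_ae' hue]; exact eGradNormSq_modes_ne_top
    have hball : ‖ue‖ ^ 2 ≤ 16 * (∫ x, ‖f x‖ ^ 2) / ν ^ 2 := by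
      rw [norm_sq_of_ae hue, le_div_iff₀ (by positivity)]
      have h1 : (∫ x, ‖(∑ mm, Torus.realTrigPoly {(![k₀] : Fin 1 → (Fin 3 → ℤ)) mm} (fun _ => (![z₀] : Fin 1 → (EuclideanSpace ℂ (Fin 3))) mm)) x‖ ^ 2) * ν ^ 2 ≤ c ^ 2 * ν ^ 2 :=
        mul_le_mul_of_nonneg_right hint1 (sq_nonneg _)
      have h2 : c ^ 2 * ν ^ 2 ≤ c ^ 2 * ν := by
        have : ν ^ 2 ≤ ν := by nlinarith
        exact mul_le_mul_of_nonneg_left this (sq_nonneg _)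
      nlinarith
    have hfl := hall ue hfin hball
    rw [nsGeneratorPairing_of_ae hue, pairing_of_ae hue, eGradNormSq_congr_ae' hue,
      inertial_mode_zero hWs k₀ z₀ hdz, hpair1, ← hM₁def, ← hE₀def, ← hΛ₀def] at hfl
    have hPD : 0 ≤ c ^ 2 - ν * E₀ := by linarith
    have hθterm : 2 * θ * (c ^ 2 - ν * E₀) ≤ 0 := mul_nonpos_of_nonpos_of_nonneg (by linarith) hPD
    have hv2 : ν * Λ₀ ≤ (ε₀ - M₁) / 4 := (mul_le_mul_of_nonneg_left (le_abs_self Λ₀) hν.le).trans hd3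
    linarith
  · /- Case B: the frozen multiplier pushes at `u₀`; the injected escaping beat. -/
    have hM₁ : ε₀ ≤ M₁ := not_lt.1 hcase
    have hM0 : 0 < M₁ := hε₀.trans_le hM₁
    /- Step 2: a nonzero mode `q` of `W = Φ'(u₀)`, the frame `(r, B)` and `ζ ≠ 0`. -/
    obtain ⟨q, hq, hgq⟩ := exists_fc_grad_ne_zero_at Φ ue (f := f) (by rw [← hM₁def]; exact hM0)
    set g : EuclideanSpace ℂ (Fin 3) := mFourierCoeff (EuclideanSpace.complexify ∘ Φ.grad ue) q with hgdef
    have hgt : ((fun j => ((q) j : ℂ)) ⬝ᵥ (WithLp.ofLp (g))) = 0 := dotc_fc_grad Φ ue q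
    obtain ⟨r, B, hr, hrq, -, hB1, hrB, hqB, hgB⟩ := frame_selection hq g hgt
    set ζ : ℂ := ⟪g, EuclideanSpace.complexify B⟫_ℂ with hζdef
    have hζ0 : ζ ≠ 0 := by
      intro h0
      rw [h0, norm_zero] at hgB
      have hg0 : ‖g‖ = 0 := by nlinarith [norm_nonneg g]
      exact hgq (norm_eq_zero.1 hg0)
    have hζn : 0 < ‖ζ‖ := norm_pos_iff.2 hζ0
    have hsq1 : 1 ≤ Real.sqrt (Torus.freqNormSq q) := by
      rw [show (1 : ℝ) = Real.sqrt 1 from Real.sqrt_one.symm]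
      exact Real.sqrt_le_sqrt (Torus.one_le_freqNormSq_of_ne_zero hq)
    /- Step 3: the amplitude `A` with `π A² |q| |ζ| ≥ M₁ + 2`. -/
    set A : ℝ := 1 + (M₁ + 2) / (Real.pi * ‖ζ‖) with hAdef
    have hπζ : 0 < Real.pi * ‖ζ‖ := mul_pos Real.pi_pos hζn
    have hA1 : 1 ≤ A := by
      rw [hAdef]
      have : 0 ≤ (M₁ + 2) / (Real.pi * ‖ζ‖) := div_nonneg (by linarith) hπζ.le
      linarith
    have hA0 : 0 < A := by linarith
    have hgain : M₁ + 2 ≤ Real.pi * A * A * Real.sqrt (Torus.freqNormSq q) * ‖ζ‖ := by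
      have h1 : Real.pi * ‖ζ‖ * A = Real.pi * ‖ζ‖ + (M₁ + 2) := by
        rw [hAdef, mul_add, mul_one, mul_div_cancel₀ _ hπζ.ne']
      have hX : 0 ≤ Real.pi * ‖ζ‖ * A := by positivity
      have h2a : Real.pi * ‖ζ‖ * A ≤ Real.pi * ‖ζ‖ * A * A := by
        nlinarith [mul_nonneg hX (sub_nonneg.2 hA1)]
      have h2b : Real.pi * ‖ζ‖ * A * A ≤ Real.pi * ‖ζ‖ * A * A * Real.sqrt (Torus.freqNormSq q) := by
        nlinarith [mul_nonneg (mul_nonneg hX hA0.le) (sub_nonneg.2 hsq1)]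
      have h3 : Real.pi * ‖ζ‖ * A * A * Real.sqrt (Torus.freqNormSq q) =
          Real.pi * A * A * Real.sqrt (Torus.freqNormSq q) * ‖ζ‖ := by ring
      linarith
    /- The polarisations of the waves. -/
    set zA : EuclideanSpace ℂ (Fin 3) := ((((A) / Real.sqrt (Torus.freqNormSq (q)) : ℝ) : ℂ) • EuclideanSpace.complexify (WithLp.toLp 2 (fun i => ((q) i : ℝ)))) with hzAdef
    set zB : EuclideanSpace ℂ (Fin 3) := (((-Complex.I * conj ((ζ)) * ((‖(ζ)‖⁻¹ : ℝ) : ℂ)) * ((A) : ℂ)) • EuclideanSpace.complexify (B)) with hzBdef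
    have hzA : ‖zA‖ = A := norm_polA hA0.le hq
    have hzB : ‖zB‖ = A := norm_polB A hA0.le hζ0 hB1
    have hqzB : ((fun j => ((q) j : ℂ)) ⬝ᵥ (WithLp.ofLp (zB))) = 0 := by
      rw [hzBdef, dotc_polB, hqB]; simp
    /- Step 4: the ray of injected beat states `u t = u₀ + Re(e_{P t} zA) + Re(e_{P t + q} zB)`. -/
    set P : ℕ → (Fin 3 → ℤ) := fun t => (fun i => (t : ℤ) * r i) + r with hPdef
    have hPzA : ∀ t, ((fun j => ((P t) j : ℂ)) ⬝ᵥ (WithLp.ofLp (zA))) = 0 := fun t => by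
      rw [hzAdef, dotc_polA, show P t ⬝ᵥ q = 0 from ray_dot hrq t]; simp
    have hPzB : ∀ t, ((fun j => ((P t) j : ℂ)) ⬝ᵥ (WithLp.ofLp (zB))) = 0 := fun t => by
      rw [hzBdef, dotc_polB, show (∑ j, ((P t j : ℝ)) * B j) = 0 from ray_sum_mul B hrB t]; simp
    have hPqzB : ∀ t, ((fun j => (((P t + q)) j : ℂ)) ⬝ᵥ (WithLp.ofLp (zB))) = 0 := fun t => by
      rw [hzBdef, dotc_polB, show (∑ j, (((P t + q) j : ℝ)) * B j) = 0 from ray_add_sum_mul B hrB hqB t]; simp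
    have hk : ∀ t, ∀ m, (![k₀, P t, P t + q] : Fin 3 → (Fin 3 → ℤ)) m ≠ 0 := fun t =>
      three_ne_zero_gen hk₀ (ray_ne_zero hr t) (ray_add_ne_zero hq hrq t)
    have hz : ∀ t, ∀ m, ((fun j => (((![k₀, P t, P t + q] : Fin 3 → (Fin 3 → ℤ)) m) j : ℂ)) ⬝ᵥ
        (WithLp.ofLp ((![z₀, zA, zB] : Fin 3 → EuclideanSpace ℂ (Fin 3)) m))) = 0 := fun t =>
      three_dotc_gen hdz (hPzA t) (hPqzB t)
    choose u hu using fun t => exists_state (![k₀, P t, P t + q]) (![z₀, zA, zB]) (hk t) (hz t)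
    /- Step 5: limits along the ray. Coefficients `cᵢ(t) = ∂ᵢφ(coords(u t)) → ∂ᵢφ(coords u₀)`. -/
    set cc : Fin Φ.m → ℕ → ℝ := fun i t => _root_.fderiv ℝ Φ.φ (Φ.coords (u t)) (EuclideanSpace.single i 1) with hccdef
    set cinf : Fin Φ.m → ℝ := fun i => _root_.fderiv ℝ Φ.φ (Φ.coords ue) (EuclideanSpace.single i 1) with hcinfdef
    -- (L1) coordinates converge to those of `u₀`
    have hL1 : ∀ i, Tendsto (fun t => Torus.pairing (((u t : (Torus.energySpace (Fin 3)))) : (Lp (EuclideanSpace ℝ (Fin 3)) 2 (volume : Measure (UnitAddTorus (Fin 3))))) (Φ.g i)) atTop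
        (𝓝 (Torus.pairing (((ue : (Torus.energySpace (Fin 3)))) : (Lp (EuclideanSpace ℝ (Fin 3)) 2 (volume : Measure (UnitAddTorus (Fin 3))))) (Φ.g i))) := by
      intro i
      have h : ∀ t, Torus.pairing (((u t : (Torus.energySpace (Fin 3)))) : (Lp (EuclideanSpace ℝ (Fin 3)) 2 (volume : Measure (UnitAddTorus (Fin 3))))) (Φ.g i) =
          (⟪z₀, mFourierCoeff (EuclideanSpace.complexify ∘ Φ.g i) k₀⟫_ℂ).re +
          ((⟪zA, mFourierCoeff (EuclideanSpace.complexify ∘ Φ.g i) ((fun j => (t : ℤ) * r j) + r)⟫_ℂ).re +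
          (⟪zB, mFourierCoeff (EuclideanSpace.complexify ∘ Φ.g i) ((fun j => (t : ℤ) * r j) + (r + q))⟫_ℂ).re) := by
        intro t
        rw [pairing_of_ae (hu t), integral_inner_modes_left (Φ.g_smooth i).integrable, Fin.sum_univ_three]
        simp only [Matrix.cons_val_zero, Matrix.cons_val_one, Matrix.cons_val_two, Matrix.head_cons, Matrix.tail_cons]
        rw [← ray_add_eq t]
        ring
      have h0 : Torus.pairing (((ue : (Torus.energySpace (Fin 3)))) : (Lp (EuclideanSpace ℝ (Fin 3)) 2 (volume : Measure (UnitAddTorus (Fin 3))))) (Φ.g i) =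
          (⟪z₀, mFourierCoeff (EuclideanSpace.complexify ∘ Φ.g i) k₀⟫_ℂ).re := by
        rw [pairing_of_ae hue, integral_inner_modes_left (Φ.g_smooth i).integrable]
        simp only [Fin.sum_univ_one, Matrix.cons_val_fin_one]
      simp_rw [h]
      rw [h0]
      simpa using ((tendsto_re_inner_fc_ray (Φ.g_smooth i) hr r zA).add
        (tendsto_re_inner_fc_ray (Φ.g_smooth i) hr (r + q) zB)).const_add
          ((⟪z₀, mFourierCoeff (EuclideanSpace.complexify ∘ Φ.g i) k₀⟫_ℂ).re)
    have hcoords : Tendsto (fun t => Φ.coords (u t)) atTop (𝓝 (Φ.coords ue)) := by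
      have hv : Tendsto (fun t => fun i => Torus.pairing (((u t : (Torus.energySpace (Fin 3)))) : (Lp (EuclideanSpace ℝ (Fin 3)) 2 (volume : Measure (UnitAddTorus (Fin 3))))) (Φ.g i)) atTop
          (𝓝 (fun i => Torus.pairing (((ue : (Torus.energySpace (Fin 3)))) : (Lp (EuclideanSpace ℝ (Fin 3)) 2 (volume : Measure (UnitAddTorus (Fin 3))))) (Φ.g i))) :=
        tendsto_pi_nhds.2 fun i => hL1 i
      exact ((PiLp.continuous_toLp 2 (fun _ : Fin Φ.m => ℝ)).tendsto _).comp hv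
    -- (L3) the coefficients converge
    have hL3 : ∀ i, Tendsto (cc i) atTop (𝓝 (cinf i)) := by
      intro i
      have hcont : Continuous fun x : EuclideanSpace ℝ (Fin Φ.m) => _root_.fderiv ℝ Φ.φ x (EuclideanSpace.single i 1) :=
        (Φ.φ_contDiff.continuous_fderiv one_ne_zero).clm_apply continuous_const
      exact (hcont.tendsto _).comp hcoords
    -- (L4) the forcing term `(f, Φ'(u t)) → M₁`
    have hL4 : Tendsto (fun t => ∫ x, ⟪f x, Φ.grad (u t) x⟫_ℝ) atTop (𝓝 M₁) := by
      have h1 : ∀ t, (∫ x, ⟪f x, Φ.grad (u t) x⟫_ℝ) = ∑ i, cc i t * ∫ x, ⟪f x, Φ.g i x⟫_ℝ := fun t =>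
        integral_inner_grad_right Φ hfi (u t)
      have h2 : M₁ = ∑ i, cinf i * ∫ x, ⟪f x, Φ.g i x⟫_ℝ := by
        rw [hM₁def, integral_inner_grad_right Φ hfi ue]
      simp_rw [h1]; rw [h2]
      exact tendsto_finsetSum _ fun i _ => (hL3 i).mul_const _
    -- (L5) the coefficient at the beat frequency converges to `g`, hence the beat converges
    have hL5 : Tendsto (fun t => mFourierCoeff (EuclideanSpace.complexify ∘ Φ.grad (u t)) q) atTop (𝓝 g) := by
      have h1 : ∀ t, mFourierCoeff (EuclideanSpace.complexify ∘ Φ.grad (u t)) q =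
          ∑ i, ((cc i t : ℝ) : ℂ) • mFourierCoeff (EuclideanSpace.complexify ∘ Φ.g i) q := fun t => fc_grad_eq_sum Φ (u t) q
      have h2 : g = ∑ i, ((cinf i : ℝ) : ℂ) • mFourierCoeff (EuclideanSpace.complexify ∘ Φ.g i) q := by
        rw [hgdef, fc_grad_eq_sum Φ ue q]
      simp_rw [h1]; rw [h2]
      exact tendsto_finsetSum _ fun i _ => ((Complex.continuous_ofReal.tendsto _).comp (hL3 i)).smul_const _
    have hbeat : Tendsto (fun t => Real.pi * (conj (((fun j => ((q) j : ℂ)) ⬝ᵥ (WithLp.ofLp (zA)))) *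
        ⟪mFourierCoeff (EuclideanSpace.complexify ∘ Φ.grad (u t)) q, zB⟫_ℂ).im) atTop
        (𝓝 (-(Real.pi * A * A * Real.sqrt (Torus.freqNormSq q) * ‖ζ‖))) := by
      have h := beat_value g hq A A B hζ0
      rw [← h]
      exact ((Complex.continuous_im.tendsto _).comp ((hL5.inner tendsto_const_nhds).const_mul _)).const_mul _
    -- (L6) the nine tail terms tend to zero (weighted Riemann–Lebesgue)
    have hr' : -r ≠ 0 := neg_ne_zero.2 hr
    have hT1 := tendsto_tail Φ u hL3 (fun t => k₀ + P t) hr (c0 := r + k₀)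
      (fun t => by funext i; simp only [hPdef, Pi.add_apply]; ring)
      (fun t => (((fun j => (((k₀ + P t)) j : ℂ)) ⬝ᵥ (WithLp.ofLp (z₀))))) z₀ zA (fun t => norm_dotc_le _ _)
    have hT2 := tendsto_tail Φ u hL3 (fun t => P t - k₀) hr (c0 := r - k₀)
      (fun t => by funext i; simp only [hPdef, Pi.add_apply, Pi.sub_apply]; ring)
      (fun t => conj (((fun j => (((P t - k₀)) j : ℂ)) ⬝ᵥ (WithLp.ofLp (z₀))))) z₀ zA
      (fun t => by rw [Complex.norm_conj]; exact norm_dotc_le _ _)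
    have hT3 := tendsto_tail Φ u hL3 (fun t => k₀ + (P t + q)) hr (c0 := r + q + k₀)
      (fun t => by funext i; simp only [hPdef, Pi.add_apply]; ring)
      (fun t => (((fun j => (((k₀ + (P t + q))) j : ℂ)) ⬝ᵥ (WithLp.ofLp (z₀))))) z₀ zB (fun t => norm_dotc_le _ _)
    have hT4 := tendsto_tail Φ u hL3 (fun t => P t + q - k₀) hr (c0 := r + q - k₀)
      (fun t => by funext i; simp only [hPdef, Pi.add_apply, Pi.sub_apply]; ring)
      (fun t => conj (((fun j => (((P t + q - k₀)) j : ℂ)) ⬝ᵥ (WithLp.ofLp (z₀))))) z₀ zB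
      (fun t => by rw [Complex.norm_conj]; exact norm_dotc_le _ _)
    have hT5 := tendsto_tail Φ u hL3 (fun t => P t + k₀) hr (c0 := r + k₀)
      (fun t => by funext i; simp only [hPdef, Pi.add_apply]; ring)
      (fun t => (((fun j => (((P t + k₀)) j : ℂ)) ⬝ᵥ (WithLp.ofLp (zA))))) zA z₀ (fun t => norm_dotc_le _ _)
    have hT6 := tendsto_tail Φ u hL3 (fun t => k₀ - P t) hr' (c0 := k₀ - r)
      (fun t => by funext i; simp only [hPdef, Pi.add_apply, Pi.sub_apply, Pi.neg_apply]; ring)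
      (fun t => conj (((fun j => (((k₀ - P t)) j : ℂ)) ⬝ᵥ (WithLp.ofLp (zA))))) zA z₀
      (fun t => by rw [Complex.norm_conj]; exact norm_dotc_le _ _)
    have hT9 := tendsto_tail Φ u hL3 (fun t => P t + (P t + q)) (two_ray_ne_zero hr) (c0 := r + r + q)
      (fun t => ray_self_sum t)
      (fun t => (((fun j => (((P t + (P t + q))) j : ℂ)) ⬝ᵥ (WithLp.ofLp (zA))))) zA zB (fun t => norm_dotc_le _ _)
    have hT7 := tendsto_tail Φ u hL3 (fun t => P t + q + k₀) hr (c0 := r + q + k₀)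
      (fun t => by funext i; simp only [hPdef, Pi.add_apply]; ring)
      (fun t => (((fun j => (((P t + q + k₀)) j : ℂ)) ⬝ᵥ (WithLp.ofLp (zB))))) zB z₀ (fun t => norm_dotc_le _ _)
    have hT8 := tendsto_tail Φ u hL3 (fun t => k₀ - (P t + q)) hr' (c0 := k₀ - r - q)
      (fun t => by funext i; simp only [hPdef, Pi.add_apply, Pi.sub_apply, Pi.neg_apply]; ring)
      (fun t => conj (((fun j => (((k₀ - (P t + q))) j : ℂ)) ⬝ᵥ (WithLp.ofLp (zB))))) zB z₀
      (fun t => by rw [Complex.norm_conj]; exact norm_dotc_le _ _)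
    -- (L7) the energy input `(u t, f) → ‖ĉ‖²`
    have hL7 : Tendsto (fun t => ∫ x, ⟪(∑ mm, Torus.realTrigPoly {(![k₀, P t, P t + q] : Fin 3 → (Fin 3 → ℤ)) mm} (fun _ => (![z₀, zA, zB] : Fin 3 → (EuclideanSpace ℂ (Fin 3))) mm)) x, f x⟫_ℝ) atTop (𝓝 (c ^ 2)) := by
      have h : ∀ t, (∫ x, ⟪(∑ mm, Torus.realTrigPoly {(![k₀, P t, P t + q] : Fin 3 → (Fin 3 → ℤ)) mm} (fun _ => (![z₀, zA, zB] : Fin 3 → (EuclideanSpace ℂ (Fin 3))) mm)) x, f x⟫_ℝ) =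
          (⟪z₀, mFourierCoeff (EuclideanSpace.complexify ∘ f) k₀⟫_ℂ).re +
          ((⟪zA, mFourierCoeff (EuclideanSpace.complexify ∘ f) ((fun j => (t : ℤ) * r j) + r)⟫_ℂ).re +
          (⟪zB, mFourierCoeff (EuclideanSpace.complexify ∘ f) ((fun j => (t : ℤ) * r j) + (r + q))⟫_ℂ).re) := by
        intro t
        rw [integral_inner_modes_left hfi, Fin.sum_univ_three]
        simp only [Matrix.cons_val_zero, Matrix.cons_val_one, Matrix.cons_val_two, Matrix.head_cons, Matrix.tail_cons]
        rw [← ray_add_eq t]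
        ring
      simp_rw [h, hinj]
      simpa using ((tendsto_re_inner_fc_ray hfs hr r zA).add (tendsto_re_inner_fc_ray hfs hr (r + q) zB)).const_add (c ^ 2)
    /- The inviscid part of the floor and its limit `≤ -2`. -/
    have hΩ : Tendsto (fun t => (∫ x, ⟪f x, Φ.grad (u t) x⟫_ℝ) +
        (Real.pi * ((((fun j => (((k₀ + P t)) j : ℂ)) ⬝ᵥ (WithLp.ofLp (z₀)))) * ⟪(mFourierCoeff (EuclideanSpace.complexify ∘ Φ.grad (u t)) (k₀ + P t)), zA⟫_ℂ).im +
            Real.pi * (conj (((fun j => (((P t - k₀)) j : ℂ)) ⬝ᵥ (WithLp.ofLp (z₀)))) * ⟪(mFourierCoeff (EuclideanSpace.complexify ∘ Φ.grad (u t)) (P t - k₀)), zA⟫_ℂ).im +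
          (Real.pi * ((((fun j => (((k₀ + (P t + q))) j : ℂ)) ⬝ᵥ (WithLp.ofLp (z₀)))) * ⟪(mFourierCoeff (EuclideanSpace.complexify ∘ Φ.grad (u t)) (k₀ + (P t + q))), zB⟫_ℂ).im +
            Real.pi * (conj (((fun j => (((P t + q - k₀)) j : ℂ)) ⬝ᵥ (WithLp.ofLp (z₀)))) * ⟪(mFourierCoeff (EuclideanSpace.complexify ∘ Φ.grad (u t)) (P t + q - k₀)), zB⟫_ℂ).im) +
        (Real.pi * ((((fun j => (((P t + k₀)) j : ℂ)) ⬝ᵥ (WithLp.ofLp (zA)))) * ⟪(mFourierCoeff (EuclideanSpace.complexify ∘ Φ.grad (u t)) (P t + k₀)), z₀⟫_ℂ).im +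
            Real.pi * (conj (((fun j => (((k₀ - P t)) j : ℂ)) ⬝ᵥ (WithLp.ofLp (zA)))) * ⟪(mFourierCoeff (EuclideanSpace.complexify ∘ Φ.grad (u t)) (k₀ - P t)), z₀⟫_ℂ).im +
          (Real.pi * ((((fun j => (((P t + (P t + q))) j : ℂ)) ⬝ᵥ (WithLp.ofLp (zA)))) * ⟪(mFourierCoeff (EuclideanSpace.complexify ∘ Φ.grad (u t)) (P t + (P t + q))), zB⟫_ℂ).im +
            Real.pi * (conj (((fun j => ((q) j : ℂ)) ⬝ᵥ (WithLp.ofLp (zA)))) * ⟪(mFourierCoeff (EuclideanSpace.complexify ∘ Φ.grad (u t)) q), zB⟫_ℂ).im)) +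
      (Real.pi * ((((fun j => (((P t + q + k₀)) j : ℂ)) ⬝ᵥ (WithLp.ofLp (zB)))) * ⟪(mFourierCoeff (EuclideanSpace.complexify ∘ Φ.grad (u t)) (P t + q + k₀)), z₀⟫_ℂ).im +
        Real.pi * (conj (((fun j => (((k₀ - (P t + q))) j : ℂ)) ⬝ᵥ (WithLp.ofLp (zB)))) * ⟪(mFourierCoeff (EuclideanSpace.complexify ∘ Φ.grad (u t)) (k₀ - (P t + q))), z₀⟫_ℂ).im))) atTop
        (𝓝 (M₁ + ((0 + 0 + (0 + 0)) + (0 + 0 + (0 + -(Real.pi * A * A * Real.sqrt (Torus.freqNormSq q) * ‖ζ‖))) + (0 + 0)))) :=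
      hL4.add ((((hT1.add hT2).add (hT3.add hT4)).add ((hT5.add hT6).add (hT9.add hbeat))).add (hT7.add hT8))
    have hlim : M₁ + ((0 + 0 + (0 + 0)) + (0 + 0 + (0 + -(Real.pi * A * A * Real.sqrt (Torus.freqNormSq q) * ‖ζ‖))) + (0 + 0)) < -1 := by
      linarith
    have hc2 : c ^ 2 / 2 < c ^ 2 := by nlinarith
    obtain ⟨t, ht, ht'⟩ := ((hΩ.eventually (gt_mem_nhds hlim)).and (hL7.eventually (lt_mem_nhds hc2))).exists
    /- Step 6: the floor at `u t` for a small viscosity and ANY weight `θ ≤ 0`. -/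
    have huU := hu t
    have hGs : Torus.IsSmooth (Φ.grad (u t)) := isSmooth_grad Φ (u t)
    have hfin : Torus.eGradNormSq (((u t : (Torus.energySpace (Fin 3))) : (Lp (EuclideanSpace ℝ (Fin 3)) 2 (volume : Measure (UnitAddTorus (Fin 3))))) : (UnitAddTorus (Fin 3) → EuclideanSpace ℝ (Fin 3))) ≠ ⊤ := by
      rw [eGradNormSq_congr_ae' huU]; exact eGradNormSq_modes_ne_top
    have hnormsq : ‖u t‖ ^ 2 ≤ (c + 2 * A) ^ 2 := by
      rw [norm_sq_of_ae huU]
      refine (integral_norm_sq_modes_le).trans ?_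
      have : (∑ m, ‖(![z₀, zA, zB] : Fin 3 → EuclideanSpace ℂ (Fin 3)) m‖) = c + 2 * A := by
        rw [Fin.sum_univ_three]
        change ‖z₀‖ + ‖zA‖ + ‖zB‖ = c + 2 * A
        rw [hz₀, hzA, hzB]; ring
      rw [this]
    -- the viscosity: upper-bound demands only
    obtain ⟨ν₁, hν₁, hdem⟩ := exists_threshold (a₁ := (c + 2 * A) ^ 2)
      (a₂ := (Torus.eGradNormSq (∑ mm, Torus.realTrigPoly {(![k₀, P t, P t + q] : Fin 3 → (Fin 3 → ℤ)) mm} (fun _ => (![z₀, zA, zB] : Fin 3 → (EuclideanSpace ℂ (Fin 3))) mm))).toReal)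
      (a₃ := (Torus.eGradNormSq (∑ mm, Torus.realTrigPoly {(![k₀, P t, P t + q] : Fin 3 → (Fin 3 → ℤ)) mm} (fun _ => (![z₀, zA, zB] : Fin 3 → (EuclideanSpace ℂ (Fin 3))) mm))).toReal)
      (a₄ := |∫ x, ⟪(∑ mm, Torus.realTrigPoly {(![k₀, P t, P t + q] : Fin 3 → (Fin 3 → ℤ)) mm} (fun _ => (![z₀, zA, zB] : Fin 3 → (EuclideanSpace ℂ (Fin 3))) mm)) x, Torus.laplacian (Φ.grad (u t)) x⟫_ℝ|)
      (b₁ := ∫ x, ‖f x‖ ^ 2) (b₂ := 1 / 4) (b₃ := c ^ 2 / 4) (b₄ := 1 / 4)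
      (sq_nonneg _) ENNReal.toReal_nonneg ENNReal.toReal_nonneg (abs_nonneg _) hF2 (by norm_num) (by positivity) (by norm_num)
    have hν : 0 < min ν₁ (min 1 (ν₀ / 2)) := lt_min hν₁ (lt_min one_pos hν₀2)
    have hνν₀ : min ν₁ (min 1 (ν₀ / 2)) < ν₀ :=
      ((min_le_right _ _).trans (min_le_right _ _)).trans_lt (half_lt_self hν₀)
    have hν1 : min ν₁ (min 1 (ν₀ / 2)) ≤ 1 := (min_le_right _ _).trans (min_le_left _ _)
    obtain ⟨hd1, hd2, hd3, hd4⟩ := hdem _ hν (min_le_left _ _)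
    obtain ⟨θ, hθ, hall⟩ := hcert _ hν hνν₀
    generalize min ν₁ (min 1 (ν₀ / 2)) = ν at hν hνν₀ hν1 hd1 hd2 hd3 hd4 hall
    -- the Leray ball
    have hball : ‖u t‖ ^ 2 ≤ 16 * (∫ x, ‖f x‖ ^ 2) / ν ^ 2 := by
      rw [le_div_iff₀ (by positivity)]
      have h1 : ‖u t‖ ^ 2 * ν ^ 2 ≤ (c + 2 * A) ^ 2 * ν ^ 2 := mul_le_mul_of_nonneg_right hnormsq (sq_nonneg _)
      have h2 : (c + 2 * A) ^ 2 * ν ^ 2 ≤ (c + 2 * A) ^ 2 * ν := by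
        have : ν ^ 2 ≤ ν := by nlinarith
        exact mul_le_mul_of_nonneg_left this (sq_nonneg _)
      nlinarith
    -- the FLOOR at `u t`, written on the representative
    have hfl := hall (u t) hfin hball
    rw [nsGeneratorPairing_of_ae huU, pairing_of_ae huU, eGradNormSq_congr_ae' huU,
      inertial_three_exact hGs k₀ (P t) q z₀ zA zB hdz (hPzA t) (hPqzB t) (hPzB t) hqzB] at hfl
    -- name the surviving scalars and conclude by linear arithmetic
    generalize (Torus.eGradNormSq (∑ mm, Torus.realTrigPoly {(![k₀, P t, P t + q] : Fin 3 → (Fin 3 → ℤ)) mm} (fun _ => (![z₀, zA, zB] : Fin 3 → (EuclideanSpace ℂ (Fin 3))) mm))).toReal = E at hfl hd2 hd3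
    generalize (∫ x, ⟪(∑ mm, Torus.realTrigPoly {(![k₀, P t, P t + q] : Fin 3 → (Fin 3 → ℤ)) mm} (fun _ => (![z₀, zA, zB] : Fin 3 → (EuclideanSpace ℂ (Fin 3))) mm)) x, Torus.laplacian (Φ.grad (u t)) x⟫_ℝ) = Λ at hfl hd4
    generalize (∫ x, ⟪(∑ mm, Torus.realTrigPoly {(![k₀, P t, P t + q] : Fin 3 → (Fin 3 → ℤ)) mm} (fun _ => (![z₀, zA, zB] : Fin 3 → (EuclideanSpace ℂ (Fin 3))) mm)) x, f x⟫_ℝ) = Pf at hfl ht'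
    generalize (∫ x, ⟪f x, Φ.grad (u t) x⟫_ℝ) = FG at hfl ht
    generalize (Real.pi * ((((fun j => (((k₀ + P t)) j : ℂ)) ⬝ᵥ (WithLp.ofLp (z₀)))) * ⟪(mFourierCoeff (EuclideanSpace.complexify ∘ Φ.grad (u t)) (k₀ + P t)), zA⟫_ℂ).im +
            Real.pi * (conj (((fun j => (((P t - k₀)) j : ℂ)) ⬝ᵥ (WithLp.ofLp (z₀)))) * ⟪(mFourierCoeff (EuclideanSpace.complexify ∘ Φ.grad (u t)) (P t - k₀)), zA⟫_ℂ).im +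
          (Real.pi * ((((fun j => (((k₀ + (P t + q))) j : ℂ)) ⬝ᵥ (WithLp.ofLp (z₀)))) * ⟪(mFourierCoeff (EuclideanSpace.complexify ∘ Φ.grad (u t)) (k₀ + (P t + q))), zB⟫_ℂ).im +
            Real.pi * (conj (((fun j => (((P t + q - k₀)) j : ℂ)) ⬝ᵥ (WithLp.ofLp (z₀)))) * ⟪(mFourierCoeff (EuclideanSpace.complexify ∘ Φ.grad (u t)) (P t + q - k₀)), zB⟫_ℂ).im) +
        (Real.pi * ((((fun j => (((P t + k₀)) j : ℂ)) ⬝ᵥ (WithLp.ofLp (zA)))) * ⟪(mFourierCoeff (EuclideanSpace.complexify ∘ Φ.grad (u t)) (P t + k₀)), z₀⟫_ℂ).im +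
            Real.pi * (conj (((fun j => (((k₀ - P t)) j : ℂ)) ⬝ᵥ (WithLp.ofLp (zA)))) * ⟪(mFourierCoeff (EuclideanSpace.complexify ∘ Φ.grad (u t)) (k₀ - P t)), z₀⟫_ℂ).im +
          (Real.pi * ((((fun j => (((P t + (P t + q))) j : ℂ)) ⬝ᵥ (WithLp.ofLp (zA)))) * ⟪(mFourierCoeff (EuclideanSpace.complexify ∘ Φ.grad (u t)) (P t + (P t + q))), zB⟫_ℂ).im +
            Real.pi * (conj (((fun j => ((q) j : ℂ)) ⬝ᵥ (WithLp.ofLp (zA)))) * ⟪(mFourierCoeff (EuclideanSpace.complexify ∘ Φ.grad (u t)) q), zB⟫_ℂ).im)) +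
      (Real.pi * ((((fun j => (((P t + q + k₀)) j : ℂ)) ⬝ᵥ (WithLp.ofLp (zB)))) * ⟪(mFourierCoeff (EuclideanSpace.complexify ∘ Φ.grad (u t)) (P t + q + k₀)), z₀⟫_ℂ).im +
        Real.pi * (conj (((fun j => (((k₀ - (P t + q))) j : ℂ)) ⬝ᵥ (WithLp.ofLp (zB)))) * ⟪(mFourierCoeff (EuclideanSpace.complexify ∘ Φ.grad (u t)) (k₀ - (P t + q))), z₀⟫_ℂ).im)) = I at hfl ht
    have hv2 : ν * Λ ≤ 1 / 4 := (mul_le_mul_of_nonneg_left (le_abs_self Λ) hν.le).trans hd4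
    have hPD : 0 ≤ Pf - ν * E := by linarith
    have hθterm : 2 * θ * (Pf - ν * E) ≤ 0 := mul_nonpos_of_nonpos_of_nonneg (by linarith) hPD
    linarith


/-- **What a witness of the crux must look like (the multiplier moves with `ν`).** For every smooth solenoidal
mean-zero force, every `ε₀ > 0` and EVERY cylindrical multiplier `Φ₁` there are arbitrarily small viscosities at
which NO weight `θ₁ ≤ 0` makes `(Φ₁, θ₁)` a floor certificate at level `ε₀`: a witness family `(Φ₁, θ₁)_ν` of
`FloorCertificate` cannot reuse one multiplier along any sequence `ν → 0`. -/
theorem frozen_multiplier_fails {f : (UnitAddTorus (Fin 3) → EuclideanSpace ℝ (Fin 3))} (hfs : Torus.IsSmooth f)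
    (hdiv : Torus.IsDivFree f) (hmean : Torus.HasZeroMean f) {ε₀ : ℝ} (hε₀ : 0 < ε₀)
    (Φ₁ : Torus.CylindricalTest (Fin 3)) {ν₁ : ℝ} (hν₁ : 0 < ν₁) :
    ∃ ν : ℝ, 0 < ν ∧ ν < ν₁ ∧ ∀ θ₁ : ℝ, θ₁ ≤ 0 → ∃ u : (Torus.energySpace (Fin 3)), ¬ FloorIneq ν f Φ₁ θ₁ ε₀ u := by
  by_contra h
  push Not at h
  exact not_floorCertificateFixedMultiplier ⟨f, hfs, hdiv, hmean, ε₀, ν₁, Φ₁, hε₀, hν₁,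
    fun ν hν hνν₁ => by
      obtain ⟨θ₁, hθ₁, hall⟩ := h ν hν hνν₁
      exact ⟨θ₁, hθ₁, hall⟩⟩

end Summit.AnomalousDissipation.AnomalousDissipation.Theorems.FloorCertificate.Negative
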